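import Literature.MathematicalPhysics.QuantumFieldTheory.Balaban1983to89.B5Eq129FreeResolventZoneSum
import Literature.MathematicalPhysics.QuantumFieldTheory.Balaban1983to89.B5Eq129FreeResolventSupBound

/-!
# `Balaban1983to89.B5Eq129FreeResolventZoneSumLetters` — T. Bałaban, *Propagators and renormalization transformations for lattice gauge theories. I*, Commun.
# Math. Phys. **95** (1984) 17–40 [Balaban1984PropagatorsI] (1.29)∕(1.31) p. 23, Prop. 1.1 p. 33, with *Propagators for lattice gauge theories in a background
# field*, Commun. Math. Phys. **99** (1985) 389–434 [Balaban1985BackgroundPropagators] (3.11) p. 392, Thm 3.1 (3.42) p. 397: **(FS-b) THE COMBINED LETTER `hFS`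
# OF THE SUP-NORM BOOTSTRAP INHABITED, LEVEL-FREE: `φ₂(x) ≤ C₃·√(Σ_y c₀ψ(y)²)` with `C₃² = m^{d−4}·c₀⁻¹·Π_ν((mN_ν)⁻¹ + π∕(4t√m))` (`d ≤ 4`); on any torus with
# `t ≤ N_ν`, `c₀t^d = c₁`, `m = 1`: `C₃ = √(3^d∕c₁)`; on the fine torus `C₃ = √(3^d∕(c₀n^d))` — LEVEL-FREE, VOLUME-FREE** (companion of `B5Eq129FreeResolventZoneSum`)

statement-level skeleton of published theorems with citation tags; proofs where landed; nothing here is a claim about the Yang–Mills mass gap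

CITATION HEADER (lean-in-tree rule).  Audit cell `pub-balaban`, sub-cell `t4`, BINDER row NE9; filed by NE9 formalisation-swarm LEAF PROVER 02 (lineage
`b2b-balaban-t4-ne9-formalise-leaf-02`, gen 70) on the row OWNER `t4-ne9-p1` g89's WORD W-2 (journal [NE9P1-G89-W2], TARGET SIGNATURE (ii) *«the COMBINED
LETTER for d ≤ 4, k = 4: hFS_fine …»*; «MINE» = [NE9LEAF02-G70-MINE-FSB]).  MECHANISM: (FS-a) `B5Eq129FreeResolventSupBound.le_of_double_resolvent_weighted`
(C. King's finite-torus `ft`: `φ₂(x) ≤ √((c₀|T|)⁻¹Σ_p(Δ_t(p)+m)⁻⁴)·√(Σ_y c₀ψ(y)²)`) composed with the level-free zone sum `B5Eq129FreeResolventZoneSum.spectral_const_le`;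
the diagonal corollary (`m = 1`, `1 ≤ t ≤ N_ν`, `c₀t^d = c₁`) bounds each factor `(N_ν)⁻¹ + π∕(4t) ≤ 3∕t`, so `C₃² ≤ c₀⁻¹(3∕t)^d = 3^d∕c₁` — free of the
level `t = η⁻¹` once `c₀t^d = c₁` is the chain's weight relation.  Sources READ first-hand (this seat,
`paper:balaban1985-cmp99-background-propagators`, PDF page + 388): p. 397 Thm 3.1 (3.42) (OCR-garbled glyphs; constants and position certain), p. 392 (3.11);
NOTHING of the random-walk proof p. 398 is reproduced.  The `[cite: …]` tags are TEXT LOCATIONS of the printed symbols only; every statement is `[folklore]`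
(ABSOLUTE RULE: nothing is minted as a cited fact).

WHAT IS PROVED (sorry-free; 0 `def`): **`hFS_tor`** (`d ≤ 4`, any torus, any `t > 0`, `m > 0`, `c₀ > 0`: the `∀ ψ φ₁ φ₂, (0 ≤ ψ) → (eq₁) → (eq₂) → ∀ x,
φ₂ x ≤ C₃·√(Σ c₀ψ²)` letter with `C₃ = √((m^{4−d})⁻¹·c₀⁻¹·Π_ν((mN_ν)⁻¹ + π∕(4t√m)))`), **`hFS_tor_diag`** (ANY torus with `t ≤ N_ν`, `c₀t^d = c₁`, `m = 1`:
`C₃ = √(3^d∕c₁)` — the shape `B5Eq129FreeResolventSupBoundSites.fs_tsite_of_tor_sumElim` transports to the `hFS` binder of `B9Eq342GreenPrime(Tower)SupBound` on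
the chain's `TSite d (towerP L m (n+1))`, `t = η⁻¹`) and **`hFS_fine`** (the OWNER's (ii) verbatim: `Tor (fine n M)`, `t = n`, `m = 1`, `C₃ = √(3^d∕(c₀·n^d))`).
v1.1 (gen 71, §5, statements ADDED, nothing removed): **`entry_const_le`** (`k ≥ d`: `|T|⁻¹Σ_p(Δ_t(p)+m)^{−k} ≤ (m^{k−d})⁻¹Π_ν((mN_ν)⁻¹ + π∕(4t√m))`,
`zone_sum_le` divided by `|T|` — the general-`k` form of `spectral_const_le`) and **`entry_const_diag_le`** (`m = 1`, `t ≤ N_ν`, `c₀t^d = c₁`: `ḡ_k∕c₀ ≤ 3^d∕c₁`) — the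
ENTRY LETTER of the decayed free letter (D-FS) `B5Eq129FreeResolventDecayedLetter.chain_apply_le_weighted` (storey (D) of the programme).
HONEST SCOPE.  [folklore] composition BY NAME of two landed∕companion files plus crude arithmetic on the constant; FREE scalar Laplacian only (no background, no
`Q′*Q′`, no window); nothing of [B9] Thm 3.1 ∕ [B5] Prop. 1.1 asserted or valued.  NOT summit progress (cell pub-balaban: NE9 NOT PRINTED ∕ NOT PROVED; «NE9 ⇐
the named binders»; row WALLED ON A MODEL (O-NE9-1; #5 UNRULED); spine PROVED 0∕9; rung (B)+1 finite T⁴ — NOT infinite volume, NOT mass gap, NOT BetaPertH,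
NOT Clay).  HONEST DEPENDENCY (cell line): continuum YM on T⁴ ⇐ BetaPertH ∧ nine spine estimates (0/9 proved); BetaPertH ⇐ (D1) ∧ (D4) ∧ CAP+tail; G-an2-4
gates asym, D1 and NE2/3/4.  NEW file importing `B5Eq129FreeResolventZoneSum` + `B5Eq129FreeResolventSupBound` only; nothing modified.  Net new unproved facts: 0.
-/

noncomputable section

open scoped BigOperators ComplexConjugate

namespace Literature.MathematicalPhysics.QuantumFieldTheory.Balaban1983to89.B5Eq129FreeResolventZoneSumLetters

open B5Prop11Plancherel (Tor chi unitVec chi_unitVec sOf abs_sOf_le fine)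
open B4Strip (S1r S1r_ge S1r_nonneg)
open B5Eq129FreeResolventSupBound (le_of_double_resolvent_weighted)
open B5Eq129FreeResolventZoneSum (spectral_const_le symbol_term_add_pos card_Tor_eq_prod zone_sum_le)

/-! ## §4 The combined letters: `hFS` of `B9Eq342SupNormBootstrap.norm_le_of_kato_bootstrap` INHABITED with a level-free `C₃` -/

section Combined

variable {d : ℕ} (N : Fin d → ℕ) [hN : ∀ μ, NeZero (N μ)]

/-- **(FS) ON `Π_ν ℤ∕N_ν`, `d ≤ 4`, EVERY MASS**: in the literal shape of the bootstrap's `hFS` ∕ of `B5Eq129FreeResolventSupBoundSites.fs_tsite_of_tor`'s `H`: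
for real `ψ ≥ 0`, `φ₁`, `φ₂` with `Σ_ν t²[(φ₁ − φ₁(·−e_ν)) + (φ₁ − φ₁(·+e_ν))] + mφ₁ = ψ` and the same from `φ₂` to `φ₁`,
`φ₂(x) ≤ C₃·√(Σ_y c₀ψ(y)²)` with `C₃ = √((m^{4−d})⁻¹·c₀⁻¹·Π_ν((m·N_ν)⁻¹ + π∕(4t√m)))` (`0 < t`, `0 < m`, `0 < c₀`).
[cite: Balaban1984PropagatorsI, (1.29) p.23, Prop. 1.1 p.33; Balaban1985BackgroundPropagators, (3.11) p.392, Thm 3.1 (3.42) p.397] -/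
theorem hFS_tor (hd : d ≤ 4) {t m c₀ : ℝ} (ht : 0 < t) (hm : 0 < m) (hc₀ : 0 < c₀) :
    ∀ ψ φ₁ φ₂ : Tor N → ℝ, (∀ x, 0 ≤ ψ x) →
      (∀ x, ∑ ν, t ^ 2 * ((φ₁ x - φ₁ (x - unitVec N ν)) + (φ₁ x - φ₁ (x + unitVec N ν))) + m * φ₁ x = ψ x) →
      (∀ x, ∑ ν, t ^ 2 * ((φ₂ x - φ₂ (x - unitVec N ν)) + (φ₂ x - φ₂ (x + unitVec N ν))) + m * φ₂ x = φ₁ x) →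
      ∀ x, φ₂ x ≤ Real.sqrt ((m ^ (4 - d))⁻¹ * c₀⁻¹ * ∏ ν, ((m * (N ν : ℝ))⁻¹ + Real.pi / (4 * t * Real.sqrt m))) *
        Real.sqrt (∑ y, c₀ * ψ y ^ 2) := by
  intro ψ φ₁ φ₂ _ h₁ h₂ x
  refine (le_of_double_resolvent_weighted N t hm hc₀ h₁ h₂ x).trans ?_
  exact mul_le_mul_of_nonneg_right (Real.sqrt_le_sqrt (spectral_const_le N hd ht hm hc₀)) (Real.sqrt_nonneg _)

end Combined

section Diagonal

variable {d : ℕ} (N : Fin d → ℕ) [hN : ∀ μ, NeZero (N μ)]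

/-- **(FS) AT THE DIAGONAL, UNIT MASS, `d ≤ 4` — THE `hFS` LETTER WITH A LEVEL-FREE, VOLUME-FREE CONSTANT `√(3^d∕c₁)`**: on ANY torus `Π_ν ℤ∕N_ν` whose sides
dominate the difference quotient (`t ≤ N_ν`, i.e. physical sides `ℓ_ν = N_ν∕t ≥ 1`) and with the diagonal weight relation `c₀·t^d = c₁` (print's `η^d`-weights,
`t = η⁻¹`, `c₁` the unit-lattice weight), mass `m = 1`: `φ₂(x) ≤ √(3^d∕c₁)·√(Σ_y c₀ψ(y)²)`. For the chain's k-th lattice `N = towerP L m (n+1)`, `t = η⁻¹ = L^{n+1}`,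
this is LITERALLY the `H` that `B5Eq129FreeResolventSupBoundSites.fs_tsite_of_tor_sumElim` turns into the `hFS` binder of `B9Eq342GreenPrime(Tower)SupBound` —
no power of the level, no volume factor. (From `hFS_tor`: `Π_ν ((1·N_ν)⁻¹ + π∕(4t)) ≤ (3∕t)^d`.) [cite: Balaban1984PropagatorsI, (1.29) p.23, Prop. 1.1 p.33;
Balaban1985BackgroundPropagators, (3.11) p.392, Thm 3.1 (3.42) p.397] -/
theorem hFS_tor_diag (hd : d ≤ 4) {t c₀ c₁ : ℝ} (ht : 0 < t) (hc₀ : 0 < c₀) (hc₁ : c₀ * t ^ d = c₁) (hvol : ∀ ν, t ≤ (N ν : ℝ)) :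
    ∀ ψ φ₁ φ₂ : Tor N → ℝ, (∀ x, 0 ≤ ψ x) →
      (∀ x, ∑ ν, t ^ 2 * ((φ₁ x - φ₁ (x - unitVec N ν)) + (φ₁ x - φ₁ (x + unitVec N ν))) + 1 * φ₁ x = ψ x) →
      (∀ x, ∑ ν, t ^ 2 * ((φ₂ x - φ₂ (x - unitVec N ν)) + (φ₂ x - φ₂ (x + unitVec N ν))) + 1 * φ₂ x = φ₁ x) →
      ∀ x, φ₂ x ≤ Real.sqrt (3 ^ d / c₁) * Real.sqrt (∑ y, c₀ * ψ y ^ 2) := by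
  intro ψ φ₁ φ₂ hψ h₁ h₂ x
  have h := hFS_tor N hd ht one_pos hc₀ ψ φ₁ φ₂ hψ h₁ h₂ x
  refine h.trans (mul_le_mul_of_nonneg_right (Real.sqrt_le_sqrt ?_) (Real.sqrt_nonneg _))
  -- `(1^{4−d})⁻¹·c₀⁻¹·Π_ν ((1·N_ν)⁻¹ + π∕(4t·√1)) ≤ 3^d∕c₁ = 3^d∕(c₀t^d)`
  have hfac : ∀ ν, ((1 : ℝ) * (N ν : ℝ))⁻¹ + Real.pi / (4 * t * Real.sqrt 1) ≤ t⁻¹ * 3 := fun ν => by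
    have hNν : 0 < (N ν : ℝ) := ht.trans_le (hvol ν)
    rw [one_mul, Real.sqrt_one, mul_one, show Real.pi / (4 * t) = t⁻¹ * (Real.pi / 4) by ring]
    have h1 : ((N ν : ℝ))⁻¹ ≤ t⁻¹ * 1 := by rw [mul_one]; exact inv_anti₀ ht (hvol ν)
    have h2 : t⁻¹ * (Real.pi / 4) ≤ t⁻¹ * 2 := mul_le_mul_of_nonneg_left (by linarith [Real.pi_le_four]) (inv_pos.2 ht).le
    linarith
  have hfac0 : ∀ ν, 0 ≤ ((1 : ℝ) * (N ν : ℝ))⁻¹ + Real.pi / (4 * t * Real.sqrt 1) := fun ν => by positivity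
  calc ((1 : ℝ) ^ (4 - d))⁻¹ * c₀⁻¹ * ∏ ν, (((1 : ℝ) * (N ν : ℝ))⁻¹ + Real.pi / (4 * t * Real.sqrt 1))
      ≤ ((1 : ℝ) ^ (4 - d))⁻¹ * c₀⁻¹ * ∏ _ν : Fin d, (t⁻¹ * 3) :=
        mul_le_mul_of_nonneg_left (Finset.prod_le_prod (fun ν _ => hfac0 ν) fun ν _ => hfac ν) (by positivity)
    _ = 3 ^ d / c₁ := by
        rw [Finset.prod_const, Finset.card_univ, Fintype.card_fin, one_pow, inv_one, one_mul, mul_pow, inv_pow, ← hc₁]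
        field_simp

end Diagonal

section Fine

variable {d : ℕ} (n : ℕ) [NeZero n] (M : Fin d → ℕ) [hM : ∀ μ, NeZero (M μ)]

/-- **(FS) ON THE FINE TORUS `Tor (fine n M)` (`N_ν = n·M_ν`, `t = n = η⁻¹`, mass `1`), `d ≤ 4` — THE OWNER's TARGET SIGNATURE (ii) VERBATIM**:
`φ₂(x) ≤ √(3^d∕(c₀·n^d))·√(Σ_y c₀ψ(y)²)`; at the diagonal `c₀n^d = c₁` the constant is `√(3^d∕c₁)`, LEVEL-FREE and VOLUME-FREE
(`hFS_tor_diag` at `c₁ := c₀n^d`, `t := n ≤ n·M_ν`). [cite: Balaban1984PropagatorsI, (1.29) p.23, Prop. 1.1 p.33; Balaban1985BackgroundPropagators, (3.11) p.392, Thm 3.1 (3.42) p.397] -/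
theorem hFS_fine (hd : d ≤ 4) {c₀ : ℝ} (hc₀ : 0 < c₀) :
    ∀ ψ φ₁ φ₂ : Tor (fine n M) → ℝ, (∀ x, 0 ≤ ψ x) →
      (∀ x, ∑ ν, (n : ℝ) ^ 2 * ((φ₁ x - φ₁ (x - unitVec (fine n M) ν)) + (φ₁ x - φ₁ (x + unitVec (fine n M) ν))) + 1 * φ₁ x = ψ x) →
      (∀ x, ∑ ν, (n : ℝ) ^ 2 * ((φ₂ x - φ₂ (x - unitVec (fine n M) ν)) + (φ₂ x - φ₂ (x + unitVec (fine n M) ν))) + 1 * φ₂ x = φ₁ x) →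
      ∀ x, φ₂ x ≤ Real.sqrt (3 ^ d / (c₀ * (n : ℝ) ^ d)) * Real.sqrt (∑ y, c₀ * ψ y ^ 2) := by
  have hn : (0 : ℝ) < n := by exact_mod_cast Nat.pos_of_ne_zero (NeZero.ne n)
  have hvol : ∀ ν, (n : ℝ) ≤ ((fine n M ν : ℕ) : ℝ) := fun ν => by
    have hMν : (1 : ℝ) ≤ M ν := by exact_mod_cast Nat.one_le_iff_ne_zero.2 (NeZero.ne (M ν))
    simp only [fine, Nat.cast_mul]
    nlinarith
  exact hFS_tor_diag (fine n M) hd hn hc₀ rfl hvol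

end Fine

/-! ## §5 (v1.1, gen 71) The entry letter `ḡ_k = |T|⁻¹Σ_p(Δ_t(p)+m)^{−k}` of the DECAYED free letter (`B5Eq129FreeResolventDecayedLetter`): LEVEL-FREE for `k ≥ d`; the diagonal -/

section EntryLetter

variable {d : ℕ} (N : Fin d → ℕ) [hN : ∀ μ, NeZero (N μ)]

/-- **THE ENTRY LETTER IS LEVEL-FREE FOR `k ≥ d`**: `ḡ_k = |T|⁻¹Σ_p(Δ_t(p)+m)^{−k} ≤ (m^{k−d})⁻¹·Π_ν((m·N_ν)⁻¹ + π∕(4t√m))` (this lineage's `zone_sum_le`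
divided by `|T| = Π_ν N_ν`). [cite: Balaban1984PropagatorsI, (1.29) p.23, Prop. 1.1 p.33; Balaban1983RegularityDecay, (2.50)–(2.51) p.586] -/
theorem entry_const_le {k : ℕ} (hk : d ≤ k) {t m : ℝ} (ht : 0 < t) (hm : 0 < m) :
    (∑ p : Tor N, (((∑ ν, t ^ 2 * (2 - 2 * (chi N p (unitVec N ν)).re)) + m) ^ k)⁻¹) / Fintype.card (Tor N) ≤
      (m ^ (k - d))⁻¹ * ∏ ν, ((m * (N ν : ℝ))⁻¹ + Real.pi / (4 * t * Real.sqrt m)) := by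
  have hz := zone_sum_le N hk ht hm
  have hNpos : ∀ ν, (0 : ℝ) < N ν := fun ν => by exact_mod_cast Nat.pos_of_ne_zero (NeZero.ne (N ν))
  have hT : (0 : ℝ) < ∏ ν, (N ν : ℝ) := Finset.prod_pos fun ν _ => hNpos ν
  rw [card_Tor_eq_prod, div_le_iff₀ hT]
  refine hz.trans (le_of_eq ?_)
  rw [show (m ^ (k - d))⁻¹ * (∏ ν, ((m * (N ν : ℝ))⁻¹ + Real.pi / (4 * t * Real.sqrt m))) * ∏ ν, (N ν : ℝ) =
      (m ^ (k - d))⁻¹ * ((∏ ν, ((m * (N ν : ℝ))⁻¹ + Real.pi / (4 * t * Real.sqrt m))) * ∏ ν, (N ν : ℝ)) from mul_assoc _ _ _,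
    ← Finset.prod_mul_distrib]
  congr 1
  refine Finset.prod_congr rfl fun ν _ => ?_
  have hN' : (N ν : ℝ) ≠ 0 := (hNpos ν).ne'
  have hm' : m ≠ 0 := hm.ne'
  have ht' : t ≠ 0 := ht.ne'
  have hs' : Real.sqrt m ≠ 0 := (Real.sqrt_pos.2 hm).ne'
  field_simp

/-- **AT THE DIAGONAL** (`m = 1`, sides `t ≤ N_ν`, weight relation `c₀·t^d = c₁`, `k ≥ d`): `ḡ_k∕c₀ ≤ 3^d∕c₁` — each factor `N_ν⁻¹ + π∕(4t) ≤ 3∕t`, LEVEL-FREE,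
VOLUME-FREE. [cite: Balaban1984PropagatorsI, (1.29) p.23, Prop. 1.1 p.33; Balaban1985BackgroundPropagators, (3.11) p.392] -/
theorem entry_const_diag_le {k : ℕ} (hk : d ≤ k) {t c₀ c₁ : ℝ} (ht : 0 < t) (hc₀ : 0 < c₀) (hc₁ : c₀ * t ^ d = c₁)
    (hvol : ∀ ν, t ≤ (N ν : ℝ)) :
    (∑ p : Tor N, (((∑ ν, t ^ 2 * (2 - 2 * (chi N p (unitVec N ν)).re)) + 1) ^ k)⁻¹) / Fintype.card (Tor N) / c₀ ≤ 3 ^ d / c₁ := by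
  have h := entry_const_le N hk ht one_pos
  have hfac : ∀ ν, ((1 : ℝ) * (N ν : ℝ))⁻¹ + Real.pi / (4 * t * Real.sqrt 1) ≤ t⁻¹ * 3 := fun ν => by
    have hNν : 0 < (N ν : ℝ) := ht.trans_le (hvol ν)
    rw [one_mul, Real.sqrt_one, mul_one, show Real.pi / (4 * t) = t⁻¹ * (Real.pi / 4) by ring]
    have h1 : ((N ν : ℝ))⁻¹ ≤ t⁻¹ * 1 := by rw [mul_one]; exact inv_anti₀ ht (hvol ν)
    have h2 : t⁻¹ * (Real.pi / 4) ≤ t⁻¹ * 2 := mul_le_mul_of_nonneg_left (by linarith [Real.pi_le_four]) (inv_pos.2 ht).le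
    linarith
  have hfac0 : ∀ ν, 0 ≤ ((1 : ℝ) * (N ν : ℝ))⁻¹ + Real.pi / (4 * t * Real.sqrt 1) := fun ν => by positivity
  have hprod : (((1 : ℝ) ^ (k - d))⁻¹ * ∏ ν, (((1 : ℝ) * (N ν : ℝ))⁻¹ + Real.pi / (4 * t * Real.sqrt 1))) ≤ (t⁻¹ * 3) ^ d := by
    rw [one_pow, inv_one, one_mul]
    calc ∏ ν, (((1 : ℝ) * (N ν : ℝ))⁻¹ + Real.pi / (4 * t * Real.sqrt 1)) ≤ ∏ _ν : Fin d, (t⁻¹ * 3) :=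
          Finset.prod_le_prod (fun ν _ => hfac0 ν) fun ν _ => hfac ν
      _ = (t⁻¹ * 3) ^ d := by rw [Finset.prod_const, Finset.card_univ, Fintype.card_fin]
  rw [div_le_div_iff₀ hc₀ (by rw [← hc₁]; positivity)]
  calc (∑ p : Tor N, (((∑ ν, t ^ 2 * (2 - 2 * (chi N p (unitVec N ν)).re)) + 1) ^ k)⁻¹) / Fintype.card (Tor N) * c₁
      ≤ (t⁻¹ * 3) ^ d * c₁ := mul_le_mul_of_nonneg_right (h.trans hprod) (by rw [← hc₁]; positivity)
    _ = 3 ^ d * c₀ := by rw [← hc₁, mul_pow, inv_pow]; field_simp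

end EntryLetter

end Literature.MathematicalPhysics.QuantumFieldTheory.Balaban1983to89.B5Eq129FreeResolventZoneSumLetters

end
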